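import Summits.HodgeConjecture.CorCM.Census.TypeStabiliserUnbounded

/-!
# `d₂(G/𝒦)` takes every value: `d`-generator subgroups of `𝒰ₑ` with `d₂ = d` exactly

COR-CM (cell `pub-hodgecm2`), count-neutral kernel combinatorics by the census seat lit-andre-3 (gen 29; lane
TYPE-STABILISER-UNBOUNDED, sequel of `Census/TypeStabiliserUnbounded.lean`).  Theorems only: no definition, no `Prop`-valued
definition, no `decide`, no certificate, no named fact, no `sorry`.  HONEST FRAMING: `HC_CM` is NOT proved, here or anywhere in
the tree; nothing here is a period or a headline.

THE QUESTION.  `Census/TypeStabiliserUnbounded.lean` proved that the excess term `d₂ = d₂(G/𝒦(G,c))` of the coinvariant fibre law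
(`Census/TypeStabiliserCharK.lean`: `φ₂(G,c) + 1 + [|G|/2 even] = β(G,c) + d₂`) is UNBOUNDED (`exists_indexTwoRank_stabGen_ge`:
for every `d` a pair with `d₂ ≥ d`).  The lane memo `HOME/pub-hodgecm2-lit-andre-3/PORTFOLIO-lit-andre-3-g24.md` §1 asserted more —
«`d₂ = d` EXACTLY for every `d`, by the `d`-generator subgroups `H_d ≤ 𝒰ₑ`» — with a machine check for `2^e ≤ 4` only.  THIS FILE makes
that sentence a kernel theorem: **for every `d : ℕ` there is a finite group `G` with a central involution `c ≠ 1` and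
`d₂(G/𝒦(G,c)) = d`** (`exists_indexTwoRank_stabGen_eq`), so `d₂` (equivalently `dim_𝔽₂ 𝔛(G,c)`, by `Census/TypeStabiliserCharK`)
takes EVERY natural value.

THE ARGUMENT (three steps, each a theorem usable on its own).
* §1 `IndexTwo.indexTwoRank_eq_card_of_dual` — an abstract DUAL-PAIR CRITERION for the `2`-rank: if `g : ι → G` generates the finite
  group `G` together with the normal subgroup `N`, and `χ : ι → Hom(G/N, ℤ/2)` is a dual family (`χ i (g i) = 1`, `χ i (g j) = 0` for
  `i ≠ j`), then `d₂(G/N) = #ι`.  Proof: the evaluation map `ev : Hom(G/N, 𝔽₂) → 𝔽₂^ι` at the generators is `𝔽₂`-linear and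
  injective (a character is determined on a generating set), so `d₂ = dim Hom(G/N, 𝔽₂) ≤ #ι` (`finrank_addChar_quotient`,
  `LinearMap.finrank_le_finrank_of_injective`); and `ev ∘ χ` is the standard basis of `𝔽₂^ι`, so `χ` is linearly independent and
  `#ι ≤ d₂`.
* §2 `stabGen_le_ker_of_rootLaw` / `indexTwoRank_stabGen_eq_card_of_rootLaw` — the ROOT-LAW form: if `f : G →* (V,+)` kills `c` and
  every `g` with `f g ≠ 0` is a root of `c` (`c ∈ ⟨g⟩`), then `𝒦(G,c) = ⟨c, non-roots⟩ ≤ ker f`, so additive functionals `φ i` on `V`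
  dual to the values `f (g i)` pull back to a dual family of characters of `G/𝒦`, and §1 gives `d₂(G/𝒦) = #ι` for a family `g`
  generating `G` together with `c`.
* §3 `FrobUT.indexTwoRank_stabGen_closure_eq` — inside the Frobenius‑unitriangular group `𝒰ₑ` of `Census/TypeStabiliserUnbounded.lean`
  (`e ≠ 0`; character `λ : 𝒰ₑ ↠ (k,+)`, `k = 𝔽_{2^{2^e}}`; ROOT LAW `u^{2^e} = c` iff `λ(u) ≠ 0`): for scalars `w : ι → k` admitting
  `𝔽₂`-dual additive functionals (i.e. `𝔽₂`-linearly independent) the subgroup `H = ⟨c, g(w i) : i⟩ ≤ 𝒰ₑ` has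
  **`d₂(H/𝒦(H,c)) = #ι` exactly** — the root law restricts to `H`, `λ(g(w i)) = w i`.  The headline takes `e = d + 1`, `w` = the first
  `d` vectors of an `𝔽₂`-basis of `k` (`dim_𝔽₂ k = 2^{d+1} ≥ d`, `GaloisField.finrank`) and their coordinate functionals.
(For `d ≥ 1` the element `c = g(w 0)^{2^e}` is redundant as a generator, so `H` is a `d`-generator `2`-group with `d(H) = d₂ = d`;
the minimal-number-of-generators half of that remark is the memoʼs, not this fileʼs.)  By memo g23 §1 (Neukirch–Schmidt–Wingberg
(9.6.7)(i)) every such pair is `(Gal(F/ℚ), complex conjugation)` for a Galois CM field `F`; that sentence is the memoʼs, not this fileʼs.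

## References
* [Pohlmann1968] H. Pohlmann, Algebraic cycles on abelian varieties of complex multiplication type, Ann. of Math. 88 (1968), Thm 1.
* [Milne1999] J. S. Milne, Lefschetz motives and the Tate conjecture, Compositio Math. 117 (1999), Prop. 2.1, p. 54.
-/

namespace Summit.HodgeConjecture.CorCM.Census.IndexTwo

section Generic

variable {G : Type*} [Group G]

/-! ## §1 A dual-pair criterion for the `2`-rank `d₂(G/N)` -/

/-- **Dual-pair criterion: `d₂(G/N) = #ι`.**  Let `G` be finite, `N ⊴ G`, `g : ι → G` a finite family generating `G` together with
`N` (`closure (N ∪ range g) = ⊤`), and `χ : ι → Hom(G/N, ℤ/2)` additive characters of `G ⧸ N` DUAL to `g`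
(`χ i (g i) = 1` and `χ i (g j) = 0` for `i ≠ j`).  Then `indexTwoRank N = Fintype.card ι`: the evaluation map at the generators
embeds `Hom(G/N, 𝔽₂)` (of `𝔽₂`-dimension `indexTwoRank N`, `finrank_addChar_quotient`) into `𝔽₂^ι` and sends `χ` to the standard
basis. [folklore] -/
theorem indexTwoRank_eq_card_of_dual [Finite G] (N : Subgroup G) [N.Normal] {ι : Type*} [Fintype ι] (g : ι → G)
    (hgen : Subgroup.closure ((N : Set G) ∪ Set.range g) = ⊤) (χ : ι → (Additive (G ⧸ N) →+ ZMod 2))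
    (hχ₁ : ∀ i, χ i (Additive.ofMul (QuotientGroup.mk (g i) : G ⧸ N)) = 1)
    (hχ₀ : ∀ i j, i ≠ j → χ i (Additive.ofMul (QuotientGroup.mk (g j) : G ⧸ N)) = 0) :
    indexTwoRank N = Fintype.card ι := by
  classical
  -- the evaluation map at the generators
  obtain ⟨ev, hev⟩ : ∃ ev : (Additive (G ⧸ N) →+ ZMod 2) →ₗ[ZMod 2] (ι → ZMod 2),
      ∀ ψ i, ev ψ i = ψ (Additive.ofMul (QuotientGroup.mk (g i) : G ⧸ N)) :=
    ⟨{ toFun := fun ψ i => ψ (Additive.ofMul (QuotientGroup.mk (g i) : G ⧸ N))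
       map_add' := fun _ _ => rfl
       map_smul' := fun _ _ => rfl }, fun _ _ => rfl⟩
  -- `ev` is injective: a character is determined by its values on `N ∪ range g`
  have hinj : Function.Injective ev := by
    intro ψ₁ ψ₂ h
    have key : (AddMonoidHom.toMultiplicativeRight ψ₁).comp (QuotientGroup.mk' N) =
        (AddMonoidHom.toMultiplicativeRight ψ₂).comp (QuotientGroup.mk' N) := by
      refine MonoidHom.eq_of_eqOn_dense hgen ?_
      rintro x (hx | ⟨i, rfl⟩)
      · have h1 : (x : G ⧸ N) = 1 := (QuotientGroup.eq_one_iff x).mpr hx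
        simp only [MonoidHom.coe_comp, Function.comp_apply, QuotientGroup.mk'_apply, h1,
          AddMonoidHom.coe_toMultiplicativeRight, ofMul_one, map_zero]
      · have hi : ev ψ₁ i = ev ψ₂ i := by rw [h]
        rw [hev, hev] at hi
        simp only [MonoidHom.coe_comp, Function.comp_apply, QuotientGroup.mk'_apply,
          AddMonoidHom.coe_toMultiplicativeRight, hi]
    refine AddMonoidHom.ext fun a => ?_
    obtain ⟨x, hx⟩ := QuotientGroup.mk_surjective (Additive.toMul a)
    have hk := DFunLike.congr_fun key x
    simp only [MonoidHom.coe_comp, Function.comp_apply, QuotientGroup.mk'_apply,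
      AddMonoidHom.coe_toMultiplicativeRight, hx, ofMul_toMul] at hk
    exact Multiplicative.ofAdd.injective hk
  haveI : Module.Finite (ZMod 2) (Additive (G ⧸ N) →+ ZMod 2) := Module.Finite.of_finite
  -- upper bound
  have hup : Module.finrank (ZMod 2) (Additive (G ⧸ N) →+ ZMod 2) ≤ Fintype.card ι := by
    have h := LinearMap.finrank_le_finrank_of_injective hinj
    rwa [Module.finrank_fintype_fun_eq_card] at h
  -- lower bound: `ev ∘ χ` is the standard basis
  have hlow : Fintype.card ι ≤ Module.finrank (ZMod 2) (Additive (G ⧸ N) →+ ZMod 2) := by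
    have hcomp : ev ∘ χ = Pi.basisFun (ZMod 2) ι := by
      funext i
      funext j
      rw [Function.comp_apply, hev, Pi.basisFun_apply, Pi.single_apply]
      split_ifs with hji
      · rw [hji, hχ₁]
      · exact hχ₀ i j (Ne.symm hji)
    have hli : LinearIndependent (ZMod 2) χ :=
      LinearIndependent.of_comp ev (by rw [hcomp]; exact (Pi.basisFun (ZMod 2) ι).linearIndependent)
    exact hli.fintype_card_le_finrank
  rw [← finrank_addChar_quotient N]
  exact le_antisymm hup hlow

end Generic

end Summit.HodgeConjecture.CorCM.Census.IndexTwo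

namespace Summit.HodgeConjecture.CorCM.Census.TypeStabiliser

open Summit.HodgeConjecture.CorCM.Census.IndexTwo

section RootLaw

variable {G : Type*} [Group G] (c : G)

/-! ## §2 The root-law form: `𝒦 ≤ ker f` and `d₂(G/𝒦) = #ι` -/

/-- **Root law ⇒ `𝒦(G,c) ≤ ker f`.**  If a homomorphism `f` kills `c` and every `g` with `f g ≠ 1` is a root of `c` (`c ∈ ⟨g⟩`), then
the type-stabiliser subgroup `𝒦(G,c) = ⟨c, {g | c ∉ ⟨g⟩}⟩` lies in `ker f` (the abstract form of `FrobUT.stabGen_le_ker`). [folklore] -/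
theorem stabGen_le_ker_of_rootLaw {M : Type*} [MulOneClass M] (f : G →* M) (hc : f c = 1)
    (hroot : ∀ g : G, f g ≠ 1 → c ∈ Subgroup.zpowers g) : stabGen c ≤ f.ker := by
  rw [stabGen_le_iff_subset]
  refine ⟨by rwa [MonoidHom.mem_ker], fun g hg => ?_⟩
  rw [MonoidHom.mem_ker]
  by_contra h
  exact hg (hroot g h)

/-- **`d₂(G/𝒦(G,c)) = #ι` from a root law with dual functionals.**  `G` finite, `c` central, `f : G →* (V,+)` with `f c = 0` and the
ROOT LAW `f g ≠ 0 ⇒ c ∈ ⟨g⟩`; `g : ι → G` generating `G` together with `c`; additive functionals `φ i : V →+ ℤ/2` dual to the values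
`f (g i)`.  Then `indexTwoRank (stabGen c) = Fintype.card ι` (§1 applied to the characters `φ i ∘ f` of `G ⧸ 𝒦`, well defined by
`stabGen_le_ker_of_rootLaw`). [folklore] -/
theorem indexTwoRank_stabGen_eq_card_of_rootLaw [Finite G] (hcen : ∀ x : G, x * c = c * x) {V : Type*} [AddMonoid V]
    (f : G →* Multiplicative V) (hc : f c = 1) (hroot : ∀ g : G, f g ≠ 1 → c ∈ Subgroup.zpowers g)
    {ι : Type*} [Fintype ι] (g : ι → G) (hgen : Subgroup.closure (insert c (Set.range g)) = ⊤)
    (φ : ι → (V →+ ZMod 2)) (hφ₁ : ∀ i, φ i (Multiplicative.toAdd (f (g i))) = 1)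
    (hφ₀ : ∀ i j, i ≠ j → φ i (Multiplicative.toAdd (f (g j))) = 0) :
    indexTwoRank (stabGen c) = Fintype.card ι := by
  haveI hN : (stabGen c).Normal := stabGen_normal c hcen
  have hker : stabGen c ≤ f.ker := stabGen_le_ker_of_rootLaw c f hc hroot
  obtain ⟨Λ, hΛ⟩ : ∃ Λ : G ⧸ stabGen c →* Multiplicative V, ∀ x : G, Λ (QuotientGroup.mk x) = f x :=
    ⟨QuotientGroup.lift (stabGen c) f hker, fun x => QuotientGroup.lift_mk (stabGen c) hker x⟩
  have hgen' : Subgroup.closure ((stabGen c : Set G) ∪ Set.range g) = ⊤ := by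
    refine top_le_iff.mp ?_
    rw [← hgen]
    exact Subgroup.closure_mono
      (Set.insert_subset (Set.mem_union_left _ (self_mem_stabGen c)) Set.subset_union_right)
  refine indexTwoRank_eq_card_of_dual (stabGen c) g hgen' (fun i => (φ i).comp (MonoidHom.toAdditiveLeft Λ))
    (fun i => ?_) (fun i j hij => ?_)
  · simp only [AddMonoidHom.coe_comp, Function.comp_apply, MonoidHom.coe_toAdditiveLeft, toMul_ofMul, hΛ, hφ₁]
  · simp only [AddMonoidHom.coe_comp, Function.comp_apply, MonoidHom.coe_toAdditiveLeft, toMul_ofMul, hΛ, hφ₀ i j hij]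

end RootLaw

noncomputable section

namespace FrobUT

variable (e : ℕ)

/-! ## §3 Inside `𝒰ₑ`: the subgroups `⟨c, g(w i)⟩` have `d₂ = #ι` exactly -/

/-- **`d₂(H/𝒦(H,c)) = #ι` for `H = ⟨c, g(w i) : i ∈ ι⟩ ≤ 𝒰ₑ`** (`e ≠ 0`), whenever the scalars `w i ∈ k = 𝔽_{2^{2^e}}` admit
`𝔽₂`-dual additive functionals `φ i` (`φ i (w i) = 1`, `φ i (w j) = 0` for `i ≠ j`, i.e. the `w i` are `𝔽₂`-linearly independent):
the root law `u^{2^e} = c` for `λ(u) ≠ 0` (`pow_two_pow_eq_c`) restricts to `H`, `λ(c) = 0` (`lam_toMat_c`), `λ(g(w)) = w`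
(`lam_genMat`), and §2 applies to `λ|_H`.  `H` is any subgroup EQUAL to that closure (`hH`), `hc` its membership witness for `c`.
[folklore] -/
theorem indexTwoRank_stabGen_closure_eq (he : e ≠ 0) {ι : Type*} [Fintype ι] (w : ι → Fq e)
    (φ : ι → (Fq e →+ ZMod 2)) (hφ₁ : ∀ i, φ i (w i) = 1) (hφ₀ : ∀ i j, i ≠ j → φ i (w j) = 0)
    (H : Subgroup (frobUT e)) (hH : H = Subgroup.closure (insert (c e) (Set.range fun i => gen e (w i))))
    (hc : c e ∈ H) : indexTwoRank (stabGen (⟨c e, hc⟩ : H)) = Fintype.card ι := by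
  subst hH
  have hg : ∀ i, gen e (w i) ∈ Subgroup.closure (insert (c e) (Set.range fun i => gen e (w i))) := fun i =>
    Subgroup.subset_closure (Set.mem_insert_of_mem _ ⟨i, rfl⟩)
  -- the character `λ` restricted to `H`
  have hf : ∀ x : Subgroup.closure (insert (c e) (Set.range fun i => gen e (w i))),
      ((lamHom e).comp (Subgroup.subtype _)) x = Multiplicative.ofAdd (lam e (toMat e (x : frobUT e))) := fun x => rfl
  refine indexTwoRank_stabGen_eq_card_of_rootLaw (⟨c e, hc⟩ : Subgroup.closure _)
    (fun y => Subtype.ext (c_comm e (y : frobUT e))) ((lamHom e).comp (Subgroup.subtype _)) ?_ ?_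
    (fun i => ⟨gen e (w i), hg i⟩) ?_ φ (fun i => ?_) (fun i j hij => ?_)
  · -- `λ(c) = 0`
    rw [hf]
    show Multiplicative.ofAdd (lam e (toMat e (c e))) = 1
    rw [lam_toMat_c e he, ofAdd_zero]
  · -- the root law inside `H`
    intro x hx
    have hne : lam e (toMat e (x : frobUT e)) ≠ 0 := fun h0 => hx (by rw [hf, h0, ofAdd_zero])
    have hpow : x ^ 2 ^ e = ⟨c e, hc⟩ := Subtype.ext (by rw [Subgroup.coe_pow]; exact pow_two_pow_eq_c hne)
    rw [← hpow]
    exact Subgroup.pow_mem _ (Subgroup.mem_zpowers x) _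
  · -- `c` and the `g(w i)` generate `H`
    refine top_le_iff.mp ((Subgroup.closure_closure_coe_preimage
      (k := insert (c e) (Set.range fun i => gen e (w i)))).symm.le.trans (Subgroup.closure_mono fun x hx => ?_))
    rcases hx with hx | ⟨i, hi⟩
    · exact Set.mem_insert_iff.mpr (Or.inl (Subtype.ext hx))
    · exact Set.mem_insert_iff.mpr (Or.inr ⟨i, Subtype.ext hi⟩)
  · -- `φ i (λ (g (w i))) = 1`
    rw [hf]
    show φ i (Multiplicative.toAdd (Multiplicative.ofAdd (lam e (toMat e (gen e (w i)))))) = 1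
    rw [toAdd_ofAdd, toMat_gen, lam_genMat, hφ₁]
  · -- `φ i (λ (g (w j))) = 0` for `i ≠ j`
    rw [hf]
    show φ i (Multiplicative.toAdd (Multiplicative.ofAdd (lam e (toMat e (gen e (w j)))))) = 0
    rw [toAdd_ofAdd, toMat_gen, lam_genMat, hφ₀ i j hij]

end FrobUT

/-! ## §4 The headline: every value of `d₂(G/𝒦)` occurs -/

/-- **`d₂(G/𝒦(G,c))` TAKES EVERY VALUE**: for every `d` there is a finite group `G` (the subgroup of the Frobenius‑unitriangular
`2`-group `𝒰_{d+1}` over `𝔽_{2^{2^{d+1}}}` generated by `c` and `d` generators `g(w i)` whose scalars `w i` are part of an `𝔽₂`-basis)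
with a central involution `c ≠ 1` and `d₂(G/𝒦(G,c)) = d` EXACTLY — sharpening `exists_indexTwoRank_stabGen_ge` (`≥ d`) of
`Census/TypeStabiliserUnbounded.lean`; by `Census/TypeStabiliserCharK` equivalently `dim_𝔽₂ 𝔛(G,c) = d`. [folklore] -/
theorem exists_indexTwoRank_stabGen_eq (d : ℕ) :
    ∃ (G : Type) (_ : Group G) (_ : Finite G) (c : G),
      c * c = 1 ∧ c ≠ 1 ∧ (∀ x : G, x * c = c * x) ∧ indexTwoRank (stabGen c) = d := by
  have he : d + 1 ≠ 0 := Nat.succ_ne_zero d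
  have hn : Module.finrank (ZMod 2) (FrobUT.Fq (d + 1)) = 2 ^ (d + 1) :=
    GaloisField.finrank 2 (pow_ne_zero _ two_ne_zero)
  let b : Module.Basis (Fin (2 ^ (d + 1))) (ZMod 2) (FrobUT.Fq (d + 1)) :=
    Module.finBasisOfFinrankEq (ZMod 2) (FrobUT.Fq (d + 1)) hn
  have hd : d ≤ 2 ^ (d + 1) := (Nat.lt_two_pow_self).le.trans (Nat.pow_le_pow_right two_pos (Nat.le_succ d))
  let w : Fin d → FrobUT.Fq (d + 1) := fun i => b (Fin.castLE hd i)
  let H : Subgroup (FrobUT.frobUT (d + 1)) :=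
    Subgroup.closure (insert (FrobUT.c (d + 1)) (Set.range fun i => FrobUT.gen (d + 1) (w i)))
  have hc : FrobUT.c (d + 1) ∈ H := Subgroup.subset_closure (Set.mem_insert _ _)
  refine ⟨H, inferInstance, inferInstance, ⟨FrobUT.c (d + 1), hc⟩, Subtype.ext (FrobUT.c_mul_c _),
    fun h => FrobUT.c_ne_one _ (congrArg Subtype.val h), fun x => Subtype.ext (FrobUT.c_comm _ (x : FrobUT.frobUT (d + 1))), ?_⟩
  rw [FrobUT.indexTwoRank_stabGen_closure_eq (d + 1) he w (fun i => (b.coord (Fin.castLE hd i)).toAddMonoidHom)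
    (fun i => ?_) (fun i j hij => ?_) H rfl hc, Fintype.card_fin]
  · show b.coord (Fin.castLE hd i) (b (Fin.castLE hd i)) = 1
    rw [Module.Basis.coord_apply, Module.Basis.repr_self, Finsupp.single_eq_same]
  · show b.coord (Fin.castLE hd i) (b (Fin.castLE hd j)) = 0
    rw [Module.Basis.coord_apply, Module.Basis.repr_self,
      Finsupp.single_eq_of_ne fun h => hij (Fin.castLE_injective hd h)]

end

end Summit.HodgeConjecture.CorCM.Census.TypeStabiliser
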